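import Summits.AtomisticToContinuum.FouriersLaw.Theorems.CageBudgetFeketeHeatVarianceCalculusLaplace
import HarnessLib

/-!
# Stub `stub_monotoneAbelOfSignedMoment` of line `Sketch`
(crux `CoercivePulse.AbelRegularity`, item stmt-AtomisticToContinuum-15384; `--supports` file, closes nothing)

WHAT. The registered stub S4 of the skeleton `Cruxes/AbelRegularity/Lines/Sketch.lean`: for a continuous `F`
with `|F| ≤ M`, Abel means `A(ν) = ∫₀^∞ e^{-νt}F(t)dt` bounded below by `b` on `(0,1]`, and the `k`-fold
integrated first moment `W_k(t) = ∫₀ᵗ(t-s)^k·sF(s)ds` of one weak sign on `[t₀,∞)`, the Abel means converge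
in `ℝ` or tend to `+∞` as `ν ↓ 0` (Pólya–Szegő II, Part V, Problems 80/82, integrated).

HOW. Pure real analysis (namespace `MonotoneAbel`): `A′(ν) = -Φ(ν)` with `Φ(ν) = ∫₀^∞ e^{-νt}·tF(t)dt`
(differentiation under the integral sign, `hasDerivAt_integral_of_dominated_loc_of_deriv_le`, dominated on
`(ν₀/2,∞)` by `Mte^{-ν₀t/2}`); `∫₀^∞ e^{-νt}W_k(t)dt = (k!/ν^{k+1})Φ(ν)` (Fubini on `(0,∞)²`, the cut-off
integrand dominated by `Mt^{k+1}e^{-νt/2}·e^{-νs/2}`, translation `t = u + s`, Euler's integral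
`∫₀^∞ u^k e^{-νu}du = k!/ν^{k+1}`); if `W_k ≥ 0` on `[t₀,∞)` then `∫₀^∞ e^{-νt}W_k ≥ -C` uniformly in `ν > 0`
(`|W_k(t)| ≤ Mt^{k+2}` on the initial segment), so `-Φ(ν) ≤ K₁ν^{k+1}` and `A - K₁ν^{k+2}/(k+2)` is antitone
on `(0,∞)` (`antitoneOn_of_hasDerivWithinAt_nonpos`); the case `W_k ≤ 0` is the previous one for `-F`.
A monotone function on `(0,∞)` converges or diverges at `0⁺` (`tendsto_atBot_of_antitone` on the subtype
`Ioi 0`, `tendsto_comp_coe_Ioi_atBot`), the monomial correction tends to `0`, and the lower bound `b` on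
`(0,1]` excludes `-∞`.
-/

noncomputable section

namespace Summit.AtomisticToContinuum.FouriersLaw.Theorems.AbelRegularity.Sketch

open MeasureTheory Filter Set Function
open scoped Topology
open Summit.AtomisticToContinuum.FouriersLaw.Theorems.HeatVarianceCalculus.CanonicalRigidity

namespace MonotoneAbel

/-- Translation on the half-line: `∫_{u > 0} f(u + c) du = ∫_{t > c} f(t) dt`. [folklore] -/
theorem setIntegral_Ioi_zero_comp_add_right (f : ℝ → ℝ) (c : ℝ) :
    ∫ u in Ioi (0 : ℝ), f (u + c) = ∫ t in Ioi c, f t := by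
  -- adapted from Literature/Analysis/FluidPDE/KochTataruKernel.lean (`setIntegral_Ioi_comp_add_right`)
  have h := (measurePreserving_add_right volume c).setIntegral_preimage_emb
    (measurableEmbedding_addRight c) f (Ioi c)
  have e : Ioi c = Ioi (0 + c) := by rw [zero_add]
  rw [e] at h ⊢
  simpa [preimage_add_const_Ioi] using h

/-- **Euler's integral** `∫₀^∞ u^k e^{-νu} du = k!/ν^{k+1}` for `ν > 0` and `k : ℕ`
(`Real.integral_rpow_mul_exp_neg_mul_Ioi`, `Real.Gamma_nat_eq_factorial`). [folklore] -/
theorem integral_pow_mul_exp_neg_mul_Ioi (k : ℕ) {ν : ℝ} (hν : 0 < ν) :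
    ∫ u in Ioi (0 : ℝ), u ^ k * Real.exp (-(ν * u)) = k.factorial / ν ^ (k + 1) := by
  -- adapted from Literature/MathematicalPhysics/StatisticalMechanics/OneCrossingMixture.lean
  have h := Real.integral_rpow_mul_exp_neg_mul_Ioi (a := (k : ℝ) + 1) (r := ν) (by positivity) hν
  rw [add_sub_cancel_right, Real.Gamma_nat_eq_factorial] at h
  calc ∫ u in Ioi (0 : ℝ), u ^ k * Real.exp (-(ν * u))
      = ∫ u in Ioi (0 : ℝ), u ^ (k : ℝ) * Real.exp (-(ν * u)) := by
        refine setIntegral_congr_fun measurableSet_Ioi (fun u _ => ?_)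
        rw [Real.rpow_natCast]
    _ = (1 / ν) ^ ((k : ℝ) + 1) * k.factorial := h
    _ = k.factorial / ν ^ (k + 1) := by
        rw [show ((k : ℝ) + 1) = ((k + 1 : ℕ) : ℝ) by push_cast; ring, Real.rpow_natCast, one_div_pow]
        ring

/-- The Laplace transform `A(ν) = ∫₀^∞ e^{-νt}F(t)dt` of a continuous bounded `F` is differentiable at every
`ν > 0`, with `A′(ν) = -∫₀^∞ e^{-νt}·tF(t)dt`. [folklore] -/
theorem hasDerivAt_laplace_of_abs_le {F : ℝ → ℝ} (hF : Continuous F) {M : ℝ} (hM : ∀ t : ℝ, |F t| ≤ M)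
    {ν : ℝ} (hν : 0 < ν) :
    HasDerivAt (fun x : ℝ => ∫ t in Ioi (0 : ℝ), Real.exp (-(x * t)) * F t)
      (-∫ t in Ioi (0 : ℝ), Real.exp (-(ν * t)) * (t * F t)) ν := by
  have hM0 : 0 ≤ M := (abs_nonneg _).trans (hM 0)
  have hs : Ioi (ν / 2) ∈ 𝓝 ν := Ioi_mem_nhds (by linarith)
  have key := _root_.hasDerivAt_integral_of_dominated_loc_of_deriv_le
    (μ := volume.restrict (Ioi (0 : ℝ))) (F := fun x t => Real.exp (-(x * t)) * F t)
    (F' := fun x t => Real.exp (-(x * t)) * (-(t * F t))) (x₀ := ν)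
    (bound := fun t => Real.exp (-(ν / 2 * t)) * (M * t)) hs ?_ ?_ ?_ ?_ ?_ ?_
  · refine key.2.congr_deriv ?_
    rw [← integral_neg]
    exact integral_congr_ae (Eventually.of_forall fun t => mul_neg _ _)
  · exact Eventually.of_forall fun x =>
      (by fun_prop : Continuous fun t : ℝ => Real.exp (-(x * t)) * F t).aestronglyMeasurable
  · exact integrableOn_exp_neg_mul_of_abs_le_pow hF (K := M) (n := 0) (fun t _ => by simpa using hM t) hν
  · exact (by fun_prop : Continuous fun t : ℝ => Real.exp (-(ν * t)) * (-(t * F t))).aestronglyMeasurable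
  · refine (ae_restrict_iff' measurableSet_Ioi).2 (Eventually.of_forall fun t ht x hx => ?_)
    have ht' : 0 < t := ht
    have hx' : ν / 2 < x := hx
    show ‖Real.exp (-(x * t)) * (-(t * F t))‖ ≤ Real.exp (-(ν / 2 * t)) * (M * t)
    rw [Real.norm_eq_abs, abs_mul, abs_of_pos (Real.exp_pos _), abs_neg, abs_mul, abs_of_pos ht']
    have h1 : Real.exp (-(x * t)) ≤ Real.exp (-(ν / 2 * t)) := Real.exp_le_exp.2 (by nlinarith)
    have h2 : t * |F t| ≤ M * t := by
      rw [mul_comm]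
      exact mul_le_mul_of_nonneg_right (hM t) ht'.le
    exact mul_le_mul h1 h2 (by positivity) (Real.exp_pos _).le
  · exact integrableOn_exp_neg_mul_of_abs_le_pow (g := fun t : ℝ => M * t) (by fun_prop) (K := M) (n := 1)
      (fun t ht => by rw [abs_mul, abs_of_nonneg hM0, pow_one, abs_of_nonneg ht]) (half_pos hν)
  · refine Eventually.of_forall fun t x _ => ?_
    exact (((hasDerivAt_id' x).mul_const t).fun_neg.exp.mul_const (F t)).congr_deriv (by ring)

/-- **Laplace transform of the `k`-fold integrated first moment.** For continuous bounded `F`, `k : ℕ` and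
`ν > 0`: `∫₀^∞ e^{-νt}(∫₀ᵗ(t-s)^k·sF(s)ds)dt = (k!/ν^{k+1})·∫₀^∞ e^{-νs}·sF(s)ds` (Fubini on `(0,∞)²` and
`∫_s^∞ e^{-νt}(t-s)^k dt = e^{-νs}k!/ν^{k+1}`). [folklore] -/
theorem integral_exp_neg_mul_iteratedMoment {F : ℝ → ℝ} (hF : Continuous F) {M : ℝ}
    (hM : ∀ t : ℝ, |F t| ≤ M) (k : ℕ) {ν : ℝ} (hν : 0 < ν) :
    ∫ t in Ioi (0 : ℝ), Real.exp (-(ν * t)) * ∫ s in (0 : ℝ)..t, (t - s) ^ k * (s * F s) =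
      (k.factorial / ν ^ (k + 1)) * ∫ s in Ioi (0 : ℝ), Real.exp (-(ν * s)) * (s * F s) := by
  have hM0 : 0 ≤ M := (abs_nonneg _).trans (hM 0)
  -- the integrand on `(0,∞)²`, cut off to the wedge `s ≤ t`
  set G : ℝ → ℝ → ℝ := fun t s =>
    if s ≤ t then Real.exp (-(ν * t)) * ((t - s) ^ k * (s * F s)) else 0 with hG
  -- (i) `t`-sections: the inner `s`-integral is `e^{-νt} W_k(t)`
  have h1 : ∀ t : ℝ, 0 < t →
      Real.exp (-(ν * t)) * ∫ s in (0 : ℝ)..t, (t - s) ^ k * (s * F s) = ∫ s in Ioi (0 : ℝ), G t s := by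
    intro t ht
    calc Real.exp (-(ν * t)) * ∫ s in (0 : ℝ)..t, (t - s) ^ k * (s * F s)
        = ∫ s in Ioc (0 : ℝ) t, Real.exp (-(ν * t)) * ((t - s) ^ k * (s * F s)) := by
          rw [MeasureTheory.integral_const_mul, intervalIntegral.integral_of_le ht.le]
      _ = ∫ s in Ioi (0 : ℝ), (Iic t).indicator
            (fun s => Real.exp (-(ν * t)) * ((t - s) ^ k * (s * F s))) s := by
          rw [setIntegral_indicator measurableSet_Iic, Ioi_inter_Iic]
      _ = ∫ s in Ioi (0 : ℝ), G t s :=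
          setIntegral_congr_fun measurableSet_Ioi fun s _ => by simp only [hG, indicator_apply, mem_Iic]
  -- (ii) `s`-sections: the inner `t`-integral is `e^{-νs} sF(s) · k!/ν^{k+1}`
  have h2 : ∀ s : ℝ, 0 < s →
      ∫ t in Ioi (0 : ℝ), G t s = (k.factorial / ν ^ (k + 1)) * (Real.exp (-(ν * s)) * (s * F s)) := by
    intro s hs
    calc ∫ t in Ioi (0 : ℝ), G t s
        = ∫ t in Ioi (0 : ℝ), (Ici s).indicator
            (fun t => Real.exp (-(ν * t)) * ((t - s) ^ k * (s * F s))) t :=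
          setIntegral_congr_fun measurableSet_Ioi fun t _ => by simp only [hG, indicator_apply, mem_Ici]
      _ = ∫ t in Ioi s, Real.exp (-(ν * t)) * ((t - s) ^ k * (s * F s)) := by
          rw [setIntegral_indicator measurableSet_Ici, inter_eq_right.2 (Ici_subset_Ioi.2 hs),
            integral_Ici_eq_integral_Ioi]
      _ = ∫ u in Ioi (0 : ℝ), Real.exp (-(ν * (u + s))) * ((u + s - s) ^ k * (s * F s)) :=
          (setIntegral_Ioi_zero_comp_add_right
            (fun t => Real.exp (-(ν * t)) * ((t - s) ^ k * (s * F s))) s).symm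
      _ = ∫ u in Ioi (0 : ℝ), (Real.exp (-(ν * s)) * (s * F s)) * (u ^ k * Real.exp (-(ν * u))) := by
          refine integral_congr_ae (Eventually.of_forall fun u => ?_)
          show Real.exp (-(ν * (u + s))) * ((u + s - s) ^ k * (s * F s)) =
            (Real.exp (-(ν * s)) * (s * F s)) * (u ^ k * Real.exp (-(ν * u)))
          rw [add_sub_cancel_right, show -(ν * (u + s)) = -(ν * u) + -(ν * s) by ring, Real.exp_add]
          ring
      _ = (k.factorial / ν ^ (k + 1)) * (Real.exp (-(ν * s)) * (s * F s)) := by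
          rw [MeasureTheory.integral_const_mul, integral_pow_mul_exp_neg_mul_Ioi k hν]
          ring
  -- (iii) integrability on the product of the two half-lines
  have h3 : Integrable (uncurry G) ((volume.restrict (Ioi (0 : ℝ))).prod (volume.restrict (Ioi (0 : ℝ)))) := by
    have hmeas : Measurable fun p : ℝ × ℝ =>
        if p.2 ≤ p.1 then Real.exp (-(ν * p.1)) * ((p.1 - p.2) ^ k * (p.2 * F p.2)) else 0 := by
      refine Measurable.ite (measurableSet_le measurable_snd measurable_fst) ?_ measurable_const
      exact (by fun_prop : Continuous fun p : ℝ × ℝ =>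
        Real.exp (-(ν * p.1)) * ((p.1 - p.2) ^ k * (p.2 * F p.2))).measurable
    have hf : IntegrableOn (fun t : ℝ => Real.exp (-(ν / 2 * t)) * (M * t ^ (k + 1))) (Ioi 0) :=
      integrableOn_exp_neg_mul_of_abs_le_pow (g := fun t : ℝ => M * t ^ (k + 1)) (by fun_prop) (K := M)
        (n := k + 1) (fun t ht => by rw [abs_mul, abs_of_nonneg hM0, abs_of_nonneg (pow_nonneg ht _)])
        (half_pos hν)
    have hg : IntegrableOn (fun s : ℝ => Real.exp (-(ν / 2 * s)) * 1) (Ioi 0) :=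
      integrableOn_exp_neg_mul_of_abs_le_pow continuous_const (K := 1) (n := 0) (fun s _ => by simp)
        (half_pos hν)
    refine (Integrable.mul_prod hf hg).mono' hmeas.aestronglyMeasurable ?_
    have hae : ∀ᵐ p : ℝ × ℝ ∂((volume.restrict (Ioi (0 : ℝ))).prod (volume.restrict (Ioi (0 : ℝ)))),
        p ∈ Ioi (0 : ℝ) ×ˢ Ioi (0 : ℝ) := by
      rw [Measure.prod_restrict]
      exact ae_restrict_mem (measurableSet_Ioi.prod measurableSet_Ioi)
    filter_upwards [hae] with p hp
    have ht : 0 < p.1 := hp.1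
    have hs : 0 < p.2 := hp.2
    show ‖(if p.2 ≤ p.1 then Real.exp (-(ν * p.1)) * ((p.1 - p.2) ^ k * (p.2 * F p.2)) else 0)‖ ≤
      Real.exp (-(ν / 2 * p.1)) * (M * p.1 ^ (k + 1)) * (Real.exp (-(ν / 2 * p.2)) * 1)
    split_ifs with hle
    · rw [Real.norm_eq_abs, abs_mul, abs_of_pos (Real.exp_pos _), abs_mul, abs_mul, abs_pow,
        abs_of_nonneg (sub_nonneg.2 hle), abs_of_pos hs, mul_one]
      have e1 : Real.exp (-(ν * p.1)) = Real.exp (-(ν / 2 * p.1)) * Real.exp (-(ν / 2 * p.1)) := by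
        rw [← Real.exp_add]
        congr 1
        ring
      have i1 : Real.exp (-(ν / 2 * p.1)) ≤ Real.exp (-(ν / 2 * p.2)) := Real.exp_le_exp.2 (by nlinarith)
      have i2 : (p.1 - p.2) ^ k ≤ p.1 ^ k := pow_le_pow_left₀ (sub_nonneg.2 hle) (by linarith) k
      have i3 : p.2 * |F p.2| ≤ p.1 * M := mul_le_mul hle (hM _) (abs_nonneg _) ht.le
      calc Real.exp (-(ν * p.1)) * ((p.1 - p.2) ^ k * (p.2 * |F p.2|))
          ≤ Real.exp (-(ν * p.1)) * (p.1 ^ k * (p.1 * M)) := by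
            refine mul_le_mul_of_nonneg_left ?_ (Real.exp_pos _).le
            exact mul_le_mul i2 i3 (by positivity) (by positivity)
        _ = Real.exp (-(ν / 2 * p.1)) * (M * p.1 ^ (k + 1)) * Real.exp (-(ν / 2 * p.1)) := by
            rw [e1]; ring
        _ ≤ Real.exp (-(ν / 2 * p.1)) * (M * p.1 ^ (k + 1)) * Real.exp (-(ν / 2 * p.2)) :=
            mul_le_mul_of_nonneg_left i1 (by positivity)
    · rw [norm_zero]; positivity
  -- assemble: Fubini
  calc ∫ t in Ioi (0 : ℝ), Real.exp (-(ν * t)) * ∫ s in (0 : ℝ)..t, (t - s) ^ k * (s * F s)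
      = ∫ t in Ioi (0 : ℝ), ∫ s in Ioi (0 : ℝ), G t s :=
        setIntegral_congr_fun measurableSet_Ioi fun t ht => h1 t ht
    _ = ∫ s in Ioi (0 : ℝ), ∫ t in Ioi (0 : ℝ), G t s := integral_integral_swap h3
    _ = ∫ s in Ioi (0 : ℝ), (k.factorial / ν ^ (k + 1)) * (Real.exp (-(ν * s)) * (s * F s)) :=
        setIntegral_congr_fun measurableSet_Ioi fun s hs => h2 s hs
    _ = (k.factorial / ν ^ (k + 1)) * ∫ s in Ioi (0 : ℝ), Real.exp (-(ν * s)) * (s * F s) :=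
        MeasureTheory.integral_const_mul _ _

/-- An antitone function on `(0, ∞)` converges in `ℝ` or tends to `+∞` at `0⁺`. [folklore] -/
theorem tendsto_or_tendsto_atTop_of_antitoneOn {g : ℝ → ℝ} (hg : AntitoneOn g (Ioi 0)) :
    (∃ L : ℝ, Tendsto g (𝓝[>] 0) (𝓝 L)) ∨ Tendsto g (𝓝[>] 0) atTop := by
  have ha : Antitone fun x : Ioi (0 : ℝ) => g x := fun x y hxy => hg x.2 y.2 hxy
  rcases tendsto_atBot_of_antitone ha with h | ⟨l, hl⟩
  · rw [tendsto_comp_coe_Ioi_atBot] at h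
    exact Or.inr h
  · rw [tendsto_comp_coe_Ioi_atBot] at hl
    exact Or.inl ⟨l, hl⟩

/-- A monotone function on `(0, ∞)` converges in `ℝ` or tends to `-∞` at `0⁺`. [folklore] -/
theorem tendsto_or_tendsto_atBot_of_monotoneOn {g : ℝ → ℝ} (hg : MonotoneOn g (Ioi 0)) :
    (∃ L : ℝ, Tendsto g (𝓝[>] 0) (𝓝 L)) ∨ Tendsto g (𝓝[>] 0) atBot := by
  have hm : Monotone fun x : Ioi (0 : ℝ) => g x := fun x y hxy => hg x.2 y.2 hxy
  rcases tendsto_atBot_of_monotone hm with h | ⟨l, hl⟩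
  · rw [tendsto_comp_coe_Ioi_atBot] at h
    exact Or.inr h
  · rw [tendsto_comp_coe_Ioi_atBot] at hl
    exact Or.inl ⟨l, hl⟩

/-- **Core of stub S4.** For continuous `F` with `|F| ≤ M` whose `k`-fold integrated first moment
`W_k(t) = ∫₀ᵗ(t-s)^k·sF(s)ds` is non-negative on `[t₀, ∞)`, the Abel curve is antitone on `(0, ∞)` up to a
monomial: `ν ↦ ∫₀^∞ e^{-νt}F(t)dt - Kν^{k+2}` is antitone for some `K`. [folklore] -/
theorem exists_antitoneOn_laplace_sub_of_moment_nonneg {F : ℝ → ℝ} (hF : Continuous F)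
    {M : ℝ} (hM : ∀ t : ℝ, |F t| ≤ M) {k : ℕ} {t₀ : ℝ}
    (hW : ∀ t : ℝ, t₀ ≤ t → 0 ≤ ∫ s in (0 : ℝ)..t, (t - s) ^ k * (s * F s)) :
    ∃ K : ℝ, AntitoneOn
      (fun ν : ℝ => (∫ t in Ioi (0 : ℝ), Real.exp (-(ν * t)) * F t) - K * ν ^ (k + 2)) (Ioi 0) := by
  have hM0 : 0 ≤ M := (abs_nonneg _).trans (hM 0)
  set W : ℝ → ℝ := fun t => ∫ s in (0 : ℝ)..t, (t - s) ^ k * (s * F s) with hWdef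
  -- `W` is continuous with `|W t| ≤ M t^{k+2}` for `t ≥ 0`
  have hWc : Continuous W := by
    have h : Continuous (Function.uncurry fun (t s : ℝ) => (t - s) ^ k * (s * F s)) := by fun_prop
    exact intervalIntegral.continuous_parametric_intervalIntegral_of_continuous (a₀ := 0) h continuous_id
  have hWb : ∀ t : ℝ, 0 ≤ t → |W t| ≤ M * t ^ (k + 2) := by
    intro t ht
    have h := intervalIntegral.norm_integral_le_of_norm_le_const (a := (0 : ℝ)) (b := t)
      (C := t ^ k * (t * M)) (f := fun s => (t - s) ^ k * (s * F s)) fun s hs => by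
        rw [uIoc_of_le ht] at hs
        rw [Real.norm_eq_abs, abs_mul, abs_mul, abs_pow, abs_of_nonneg (sub_nonneg.2 hs.2),
          abs_of_nonneg hs.1.le]
        exact mul_le_mul (pow_le_pow_left₀ (sub_nonneg.2 hs.2) (by linarith [hs.1]) k)
          (mul_le_mul hs.2 (hM s) (abs_nonneg _) ht) (mul_nonneg hs.1.le (abs_nonneg _)) (pow_nonneg ht _)
    rw [Real.norm_eq_abs, sub_zero, abs_of_nonneg ht] at h
    calc |W t| ≤ t ^ k * (t * M) * t := h
      _ = M * t ^ (k + 2) := by ring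
  -- beyond `T = max t₀ 0` the moment is non-negative
  set T : ℝ := max t₀ 0 with hT
  have hT0 : 0 ≤ T := le_max_right _ _
  have hWT : ∀ t : ℝ, T ≤ t → 0 ≤ W t := fun t ht => hW t ((le_max_left _ _).trans ht)
  -- a `ν`-independent lower bound of the Laplace transform of `W`
  set ℓ : ℝ → ℝ := fun t => Real.exp (-(1 * t)) * (-(M * T ^ (k + 2) * Real.exp T)) with hℓ
  have hℓi : IntegrableOn ℓ (Ioi 0) :=
    integrableOn_exp_neg_mul_of_abs_le_pow continuous_const (K := |-(M * T ^ (k + 2) * Real.exp T)|)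
      (n := 0) (fun t _ => by rw [pow_zero, mul_one]) one_pos
  have hlow : ∀ ν : ℝ, 0 < ν →
      ∫ t in Ioi (0 : ℝ), ℓ t ≤ ∫ t in Ioi (0 : ℝ), Real.exp (-(ν * t)) * W t := by
    intro ν hν
    refine setIntegral_mono_on hℓi (integrableOn_exp_neg_mul_of_abs_le_pow hWc hWb hν)
      measurableSet_Ioi fun t ht => ?_
    have ht' : 0 < t := ht
    show Real.exp (-(1 * t)) * (-(M * T ^ (k + 2) * Real.exp T)) ≤ Real.exp (-(ν * t)) * W t
    rcases le_or_gt T t with hTt | htT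
    · have h1 : 0 ≤ Real.exp (-(ν * t)) * W t := mul_nonneg (Real.exp_pos _).le (hWT t hTt)
      have h2 : Real.exp (-(1 * t)) * (-(M * T ^ (k + 2) * Real.exp T)) ≤ 0 :=
        mul_nonpos_of_nonneg_of_nonpos (Real.exp_pos _).le (neg_nonpos.2 (by positivity))
      exact h2.trans h1
    · have h1 : |W t| ≤ M * T ^ (k + 2) :=
        (hWb t ht'.le).trans (mul_le_mul_of_nonneg_left (pow_le_pow_left₀ ht'.le htT.le _) hM0)
      have h2 : Real.exp (-(ν * t)) ≤ 1 := Real.exp_le_one_iff.2 (by nlinarith)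
      have h3 : 1 ≤ Real.exp (-(1 * t)) * Real.exp T := by
        rw [← Real.exp_add]
        exact Real.one_le_exp (by linarith)
      have h4 : -(M * T ^ (k + 2)) ≤ Real.exp (-(ν * t)) * W t := by
        have h5 : -(Real.exp (-(ν * t)) * |W t|) ≤ Real.exp (-(ν * t)) * W t := by
          rw [← mul_neg]
          exact mul_le_mul_of_nonneg_left (neg_abs_le _) (Real.exp_pos _).le
        refine le_trans ?_ h5
        rw [neg_le_neg_iff]
        calc Real.exp (-(ν * t)) * |W t| ≤ 1 * |W t| := mul_le_mul_of_nonneg_right h2 (abs_nonneg _)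
          _ ≤ M * T ^ (k + 2) := by rw [one_mul]; exact h1
      refine le_trans ?_ h4
      have h6 : M * T ^ (k + 2) * 1 ≤ M * T ^ (k + 2) * (Real.exp (-(1 * t)) * Real.exp T) :=
        mul_le_mul_of_nonneg_left h3 (by positivity)
      calc Real.exp (-(1 * t)) * (-(M * T ^ (k + 2) * Real.exp T))
          = -(M * T ^ (k + 2) * (Real.exp (-(1 * t)) * Real.exp T)) := by ring
        _ ≤ -(M * T ^ (k + 2) * 1) := neg_le_neg h6
        _ = -(M * T ^ (k + 2)) := by rw [mul_one]
  set C : ℝ := ∫ t in Ioi (0 : ℝ), ℓ t with hC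
  -- one-sided bound of the derivative `A′(ν) = -Φ(ν)`
  obtain ⟨K₁, hK₁⟩ : ∃ K₁ : ℝ, ∀ ν : ℝ, 0 < ν →
      -(∫ t in Ioi (0 : ℝ), Real.exp (-(ν * t)) * (t * F t)) ≤ K₁ * ν ^ (k + 1) := by
    refine ⟨-C / k.factorial, fun ν hν => ?_⟩
    set Φ : ℝ := ∫ t in Ioi (0 : ℝ), Real.exp (-(ν * t)) * (t * F t) with hΦ
    have hfac : (0 : ℝ) < k.factorial := by exact_mod_cast k.factorial_pos
    have hνk : 0 < ν ^ (k + 1) := pow_pos hν _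
    have hlo : C ≤ (k.factorial : ℝ) / ν ^ (k + 1) * Φ :=
      calc C ≤ ∫ t in Ioi (0 : ℝ), Real.exp (-(ν * t)) * W t := hlow ν hν
        _ = (k.factorial : ℝ) / ν ^ (k + 1) * Φ := integral_exp_neg_mul_iteratedMoment hF hM k hν
    have h1 := mul_le_mul_of_nonneg_right hlo (le_of_lt (div_pos hνk hfac))
    have e : (k.factorial : ℝ) / ν ^ (k + 1) * Φ * (ν ^ (k + 1) / k.factorial) = Φ := by
      field_simp
    rw [e] at h1
    have e2 : -C / (k.factorial : ℝ) * ν ^ (k + 1) = -(C * (ν ^ (k + 1) / k.factorial)) := by ring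
    rw [e2]
    exact neg_le_neg h1
  -- the corrected Abel curve is antitone
  refine ⟨K₁ / (k + 2), ?_⟩
  have hderiv : ∀ x ∈ Ioi (0 : ℝ), HasDerivAt
      (fun ν : ℝ => (∫ t in Ioi (0 : ℝ), Real.exp (-(ν * t)) * F t) - K₁ / (k + 2) * ν ^ (k + 2))
      (-(∫ t in Ioi (0 : ℝ), Real.exp (-(x * t)) * (t * F t)) - K₁ * x ^ (k + 1)) x := by
    intro x hx
    have h1 := hasDerivAt_laplace_of_abs_le hF hM (mem_Ioi.1 hx)
    have h2 : HasDerivAt (fun ν : ℝ => K₁ / (k + 2) * ν ^ (k + 2)) (K₁ * x ^ (k + 1)) x := by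
      refine ((hasDerivAt_pow (k + 2) x).const_mul (K₁ / (k + 2))).congr_deriv ?_
      rw [show k + 2 - 1 = k + 1 by omega]
      have hk2 : ((k : ℝ) + 2) ≠ 0 := by positivity
      push_cast
      field_simp
    exact h1.sub h2
  refine antitoneOn_of_hasDerivWithinAt_nonpos (convex_Ioi 0)
    (f' := fun x : ℝ => -(∫ t in Ioi (0 : ℝ), Real.exp (-(x * t)) * (t * F t)) - K₁ * x ^ (k + 1))
    (fun x hx => (hderiv x hx).continuousAt.continuousWithinAt) ?_ ?_
  · rw [interior_Ioi]
    exact fun x hx => (hderiv x hx).hasDerivWithinAt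
  · rw [interior_Ioi]
    intro x hx
    have h := hK₁ x hx
    linarith

end MonotoneAbel

open MonotoneAbel

/-- **Stub S4 — `monotoneAbelOfSignedMoment` (registered signature, verbatim): one eventual sign of an
iterated first moment makes the Abel curve monotone up to a polynomial (Pólya–Szegő II.V.80/82 integrated).**
For continuous `F` with `|F| ≤ M`, `A[F]` bounded below by `b` on `(0,1]`, and
`W_k(t) = ∫₀ᵗ(t-s)^k·sF(s)ds` of one weak sign on `[t₀,∞)`: `A[F](ν) = ∫₀^∞ e^{-νt}F(t)dt` converges in `ℝ`
or tends to `+∞` as `ν ↓ 0`. [cite: PolyaSzego1976, Part V Problems 80, 82] -/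
theorem stub_monotoneAbelOfSignedMoment :
    ∀ (F : ℝ → ℝ) (M b t₀ : ℝ) (k : ℕ), Continuous F → (∀ t : ℝ, |F t| ≤ M) → (∀ ν : ℝ, 0 < ν → ν ≤ 1 → b ≤ ∫ t in Set.Ioi (0:ℝ), Real.exp (-(ν * t)) * F t) → ((∀ t : ℝ, t₀ ≤ t → 0 ≤ ∫ s in (0:ℝ)..t, (t - s) ^ k * (s * F s)) ∨ (∀ t : ℝ, t₀ ≤ t → ∫ s in (0:ℝ)..t, (t - s) ^ k * (s * F s) ≤ 0)) → (∃ L : ℝ, Filter.Tendsto (fun ν : ℝ => ∫ t in Set.Ioi (0:ℝ), Real.exp (-(ν * t)) * F t) (nhdsWithin (0:ℝ) (Set.Ioi 0)) (nhds L)) ∨ Filter.Tendsto (fun ν : ℝ => ∫ t in Set.Ioi (0:ℝ), Real.exp (-(ν * t)) * F t) (nhdsWithin (0:ℝ) (Set.Ioi 0)) Filter.atTop := by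
  intro F M b t₀ k hF hM hb hsign
  -- the monomial correction tends to `0` at `0⁺`
  have hp : ∀ K : ℝ, Tendsto (fun ν : ℝ => K * ν ^ (k + 2)) (𝓝[>] 0) (𝓝 0) := fun K => by
    have h : Tendsto (fun ν : ℝ => K * ν ^ (k + 2)) (𝓝 0) (𝓝 (K * 0 ^ (k + 2))) :=
      (by fun_prop : Continuous fun ν : ℝ => K * ν ^ (k + 2)).tendsto 0
    have hk : (0 : ℝ) ^ (k + 2) = 0 := zero_pow (by positivity)
    rw [hk, mul_zero] at h
    exact tendsto_nhdsWithin_of_tendsto_nhds h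
  rcases hsign with hpos | hneg
  · -- `W_k ≥ 0` eventually: `A - Kν^{k+2}` is antitone
    obtain ⟨K, hK⟩ := exists_antitoneOn_laplace_sub_of_moment_nonneg hF hM hpos
    rcases tendsto_or_tendsto_atTop_of_antitoneOn hK with ⟨L, hL⟩ | htop
    · have h := hL.add (hp K)
      rw [add_zero] at h
      exact Or.inl ⟨L, h.congr fun ν => by ring⟩
    · exact Or.inr ((htop.atTop_add (hp K)).congr fun ν => by ring)
  · -- `W_k ≤ 0` eventually: apply the previous case to `-F`; `A + Kν^{k+2}` is monotone
    have hF' : Continuous fun t => -F t := hF.neg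
    have hM' : ∀ t : ℝ, |(-F t)| ≤ M := fun t => by rw [abs_neg]; exact hM t
    have hpos' : ∀ t : ℝ, t₀ ≤ t → 0 ≤ ∫ s in (0 : ℝ)..t, (t - s) ^ k * (s * (-F s)) := by
      intro t ht
      have e : ∫ s in (0 : ℝ)..t, (t - s) ^ k * (s * (-F s)) =
          -∫ s in (0 : ℝ)..t, (t - s) ^ k * (s * F s) := by
        rw [← intervalIntegral.integral_neg]
        exact intervalIntegral.integral_congr fun s _ => by ring
      rw [e]
      linarith [hneg t ht]
    obtain ⟨K, hK⟩ := exists_antitoneOn_laplace_sub_of_moment_nonneg hF' hM' hpos'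
    have hA' : ∀ ν : ℝ, ∫ t in Ioi (0 : ℝ), Real.exp (-(ν * t)) * (-F t) =
        -∫ t in Ioi (0 : ℝ), Real.exp (-(ν * t)) * F t := fun ν => by
      rw [← integral_neg]
      exact integral_congr_ae (Eventually.of_forall fun t => mul_neg _ _)
    have hmono : MonotoneOn
        (fun ν : ℝ => (∫ t in Ioi (0 : ℝ), Real.exp (-(ν * t)) * F t) + K * ν ^ (k + 2)) (Ioi 0) := by
      intro x hx y hy hxy
      have h := hK hx hy hxy
      simp only [hA'] at h
      linarith
    rcases tendsto_or_tendsto_atBot_of_monotoneOn hmono with ⟨L, hL⟩ | hbot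
    · have h := hL.sub (hp K)
      rw [sub_zero] at h
      exact Or.inl ⟨L, h.congr fun ν => by ring⟩
    · exfalso
      have h2 : Tendsto (fun ν : ℝ => ∫ t in Ioi (0 : ℝ), Real.exp (-(ν * t)) * F t) (𝓝[>] 0) atBot :=
        (hbot.atBot_add (hp (-K))).congr fun ν => by ring
      have h3 : ∀ᶠ ν in 𝓝[>] (0 : ℝ), (∫ t in Ioi (0 : ℝ), Real.exp (-(ν * t)) * F t) < b :=
        h2.eventually (eventually_lt_atBot b)
      have h4 : ∀ᶠ ν in 𝓝[>] (0 : ℝ), ν ∈ Ioo (0 : ℝ) 1 := Ioo_mem_nhdsGT one_pos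
      obtain ⟨ν, hν1, hν2⟩ := (h3.and h4).exists
      exact absurd (hb ν hν2.1 hν2.2.le) (not_le.2 hν1)

end Summit.AtomisticToContinuum.FouriersLaw.Theorems.AbelRegularity.Sketch

end
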